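import Summits.ResolutionOfSingularities.ResolutionOfSingularities.Theorems.HomologicalConductorNoZenoBranchLift
import Summits.ResolutionOfSingularities.ResolutionOfSingularities.Theorems.HomologicalConductorNoZenoTransversalRegular
import Summits.ResolutionOfSingularities.ResolutionOfSingularities.Theorems.HomologicalConductorNoZenoSepNodesFinite
import HarnessLib

/-!
# Crux `NoZenoR` (stmt-ResolutionOfSingularities-19943), slot 5 `stub_L1wCoreF3`, seam2 (m3) disjunct 2 — (S1) DOWNSTAIRS
# SEP-JUMP at a self-node: `2 ≤ [κ(y)^s : κ(z)]` at THE point `y` of the node curve over a non-`𝒩₀` node `z`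

OURS (cell res-hironaka, chain W4.4; stub worker res-L0-w44-stub-4 g8; piece (S1) of res-L0-w44-plan-1 RULING (ρ53e) /
DESK WORD 20 (b)).  Nothing here is a statement of the manuscript under review (Hironaka 2017); AI-written, weaker than
expert review; def-free; conditional only on the Literature fact `Lipman1969_13_1_d_rat` (through res-D-pv-045's (T1)/(T3)).

Setting (ROUTE M, by signature).  `π : X → Spec S` a resolution of the two-dimensional normal local domain `S` with a
RATIONAL singularity, `ρ : X¹ → X` proper with `ρ ≫ π` again a resolution (the node blow-up, res-L1-type-o5
`NodeBlowup.isResolution_comp`), `η¹, n` two distinct integral exceptional curves of `ρ ≫ π` meeting at `y` (`η¹` the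
lift of an old curve `η = ρ η¹`, `n` the node curve over `z`, `ρ⁻¹{z} ⊆ closure {n}`), and `z ∈ sepNodes π` a node through
which `η` is the ONLY exceptional curve of `π`.

* `isBranchAt_comap_symm_of_node` — EVERY branch `V` of `E_η` at `z` becomes, along `κ(η) ≅ κ(η¹)`
  (`ρ.stalkMap η¹` bijective), a branch of `E¹ = closure {η¹}` at THE point `y`, and equals the curve germ `𝒪_(E¹,y)`:
  (S1a) `exists_isBranchAt_lift` gives a branch point `y′` over `z`, `y′ ∈ ρ⁻¹{z} ⊆ closure {n}`, so `y′ = y` by (T1)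
  `eq_of_specializes_of_specializes`; `E¹` is regular at `y` by (T3) `isRegularLocalRing_stalk_ofPoint_of_specializes`, so its
  germ is a valuation ring (res-L1-type-o5 `forall_mem_or_inv_mem_of_mem_regularLocus`) and the branch IS the germ
  (`toSubring_eq_curveGerm_of_forall_mem_or_inv_mem`);
* `eq_of_isBranchAt_of_isBranchAt_of_node` — hence `E_η` has only ONE branch at `z` (no two branch data);
* `branchSepDegree_eq_finrank_separableClosure_of_node` — and the separable residue degree of that branch over `κ(z)` is
  `[κ(y)^s : κ(z)]` (the residue field of the branch is `κ(y)`: `𝒪_(X¹,y) → V¹` is onto; the `κ(z)`-structures agree by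
  naturality of `stalkSpecializes` / `residue`);
* **`two_le_finrank_separableClosure_of_selfNode`** — (S1): `z ∈ sepNodes π` with no second curve through `z` forces the
  second clause of `sepNodes` for the curve `η`, i.e. `2 ≤ branchSepDegree`, i.e. **`2 ≤ [κ(y)^s : κ(ρ y)]`** along
  `ρ.residueFieldMap y` (and `ρ y = z`, `base_eq_of_specializes_of_mem_sepNodes`).

References: J. Lipman, Publ. Math. IHÉS 36 (1969), Prop. (13.1) d) p. 223, §16 (16.1) p. 231 [`Lipman1969`]; The Stacks
Project, Tags 01KF, 01KZ [`StacksProject`].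
-/

noncomputable section

-- single-problem summit: the doubled namespace component `ResolutionOfSingularities` is forced
set_option linter.dupNamespace false

namespace Summit.ResolutionOfSingularities.ResolutionOfSingularities.Theorems.NoZeno.ExcCount

open CategoryTheory AlgebraicGeometry TopologicalSpace IsLocalRing
open Literature.AlgebraicGeometry.Resolution Literature.AlgebraicGeometry.Motives

section SelfNode

/-- A node is a closed point, so a point to which it specialises is the node: if `ρ n = z ∈ sepNodes π` and `n ⤳ y`
then `ρ y = z`. [folklore] -/
theorem base_eq_of_specializes_of_mem_sepNodes {S : Type} [CommRing S] [IsLocalRing S] {X X1 : Scheme.{0}}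
    {π : X ⟶ Spec (.of S)} (ρ : X1 ⟶ X) {z : X} (hz : z ∈ sepNodes π) {n y : X1} (hn : ρ.base n = z)
    (hy : n ⤳ y) : ρ.base y = z := by
  have hsp : z ⤳ ρ.base y := hn ▸ hy.map ρ.base.hom.continuous
  exact ((isClosed_singleton_of_mem_sepNodes π hz).closure_eq ▸ specializes_iff_mem_closure.mp hsp :
    ρ.base y ∈ ({z} : Set X))

variable {S : Type} [CommRing S] [IsNoetherianRing S] [IsLocalRing S] [IsDomain S] [IsIntegrallyClosed S]
  {X X1 : Scheme.{0}} [IsIntegral X1] [IsLocallyNoetherian X1]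
  {π : X ⟶ Spec (.of S)} (ρ : X1 ⟶ X) [IsProper ρ]

/-- **Every branch of the old curve at the node is the germ of its strict transform at THE point over the node.**
With `e : κ(η) ≃ κ(η¹)` the residue field identification (`ρ.stalkMap η¹` bijective), a branch `V` of `closure {ρ η¹}` at
`z` gives `V¹ := V.comap e⁻¹`, a branch of `closure {η¹}` at `y`, equal to the (valuation-ring) curve germ `𝒪_(E¹, y)`; and
`ρ y = z`. [cite: Lipman1969, Proposition (13.1) d) (p. 223)] -/
theorem isBranchAt_comap_symm_of_node (h131d : Lipman1969_13_1_d_rat.{0}) (hdim : ringKrullDim S = 2)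
    (hS : HasRationalSingularity S) (hψ : IsResolution (ρ ≫ π))
    {η1 n y : X1} (hη1 : η1 ∈ excCurvePoints (ρ ≫ π)) (hn : n ∈ excCurvePoints (ρ ≫ π)) (hne : η1 ≠ n)
    (hy1 : η1 ⤳ y) (hy2 : n ⤳ y) {z : X} (hfib : ρ.base ⁻¹' {z} ⊆ closure {n})
    (e : X.residueField (ρ.base η1) ≃+* X1.residueField η1) (he : ∀ t, e t = (ρ.residueFieldMap η1).hom t)
    (h : ρ.base η1 ⤳ z) {V : ValuationSubring (X.residueField (ρ.base η1))} (hb : IsBranchAt z (ρ.base η1) h V) :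
    ρ.base y = z ∧ IsBranchAt y η1 hy1 (V.comap e.symm.toRingHom) ∧
      (∀ x : X1.residueField η1, x ∈ curveGerm y η1 hy1 ∨ x⁻¹ ∈ curveGerm y η1 hy1) ∧
      (V.comap e.symm.toRingHom).toSubring = curveGerm y η1 hy1 := by
  set V1 : ValuationSubring (X1.residueField η1) := V.comap e.symm.toRingHom with hV1
  -- `V = V¹ ∩ κ(η)`
  have hVV : V1.comap (ρ.residueFieldMap η1).hom = V := by
    ext t
    rw [ValuationSubring.mem_comap, hV1, ValuationSubring.mem_comap, ← he]
    change e.symm (e t) ∈ V ↔ t ∈ V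
    rw [e.symm_apply_apply]
  have hb' : IsBranchAt z (ρ.base η1) h (V1.comap (ρ.residueFieldMap η1).hom) := by rw [hVV]; exact hb
  -- (S1a): the branch lives at some `y′` over `z`
  obtain ⟨y', h1', hρy', hb1'⟩ := exists_isBranchAt_lift ρ η1 h V1 hb'
  -- `y′ = y` by (T1): both lie on `E¹` and on the node curve `n`
  have hny' : n ⤳ y' := by
    have : y' ∈ ρ.base ⁻¹' {z} := hρy'
    exact specializes_iff_mem_closure.mpr (hfib this)
  have hyy : y = y' := eq_of_specializes_of_specializes h131d hdim hS hψ hη1 hn hne hy1 hy2 h1' hny'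
  subst hyy
  -- (T3): `E¹` is regular at `y`, so its germ is a valuation ring of `κ(η¹)`
  have hreg := isRegularLocalRing_stalk_ofPoint_of_specializes h131d hdim hS hψ hη1 hn hne hy1 hy2
  have hW : ∀ x : X1.residueField η1, x ∈ curveGerm y η1 hy1 ∨ x⁻¹ ∈ curveGerm y η1 hy1 :=
    forall_mem_or_inv_mem_of_mem_regularLocus hη1.2.le (ClosedSubvariety.ofPointPt η1 hy1)
      ((Scheme.mem_regularLocus _).mpr hreg) hy1 (ClosedSubvariety.ofPoint_ι_ofPointPt η1 hy1)
  exact ⟨hρy', hb1', hW, toSubring_eq_curveGerm_of_forall_mem_or_inv_mem hy1 hW hb1'⟩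

/-- **The old curve has only one branch at the node**: two branches of `closure {ρ η¹}` at `z` coincide (both equal the
germ of `E¹` at `y` read in `κ(η)`). [cite: Lipman1969, Proposition (13.1) d) (p. 223)] -/
theorem eq_of_isBranchAt_of_isBranchAt_of_node (h131d : Lipman1969_13_1_d_rat.{0}) (hdim : ringKrullDim S = 2)
    (hS : HasRationalSingularity S) (hψ : IsResolution (ρ ≫ π))
    {η1 n y : X1} (hη1 : η1 ∈ excCurvePoints (ρ ≫ π)) (hn : n ∈ excCurvePoints (ρ ≫ π)) (hne : η1 ≠ n)
    (hy1 : η1 ⤳ y) (hy2 : n ⤳ y) {z : X} (hfib : ρ.base ⁻¹' {z} ⊆ closure {n})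
    (hbij : Function.Bijective (ρ.stalkMap η1))
    {h h' : ρ.base η1 ⤳ z} {V V' : ValuationSubring (X.residueField (ρ.base η1))}
    (hb : IsBranchAt z (ρ.base η1) h V) (hb' : IsBranchAt z (ρ.base η1) h' V') : V = V' := by
  let e : X.residueField (ρ.base η1) ≃+* X1.residueField η1 :=
    RingEquiv.ofBijective (ρ.residueFieldMap η1).hom (residueFieldMap_bijective_of_stalkMap_bijective ρ η1 hbij)
  have he : ∀ t, e t = (ρ.residueFieldMap η1).hom t := fun _ => rfl
  obtain ⟨-, -, -, hV⟩ := isBranchAt_comap_symm_of_node ρ h131d hdim hS hψ hη1 hn hne hy1 hy2 hfib e he h hb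
  obtain ⟨-, -, -, hV'⟩ := isBranchAt_comap_symm_of_node ρ h131d hdim hS hψ hη1 hn hne hy1 hy2 hfib e he h' hb'
  have h1 : V.comap e.symm.toRingHom = V'.comap e.symm.toRingHom :=
    ValuationSubring.toSubring_injective (hV.trans hV'.symm)
  rw [← valuationSubring_comap_comap_symm V e, ← valuationSubring_comap_comap_symm V' e, h1]

/-- **The separable residue degree of the branch is `[κ(y)^s : κ(z)]`.**  For the (unique) branch `V` of the old curve
at the node `z = ρ y`, `branchSepDegree z η _ V = [κ(y)^s : κ(ρ y)]`, the residue field of `y` as an extension of `κ(ρ y)`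
along `ρ.residueFieldMap y`: the residue field of `V ≅ V¹ = 𝒪_(E¹,y)` is `κ(y)` (`𝒪_(X¹,y) → V¹` is onto), compatibly with
the `κ(z)`-structures. [cite: Lipman1969, §16 (16.1), (16.5) (pp. 231–235)] -/
theorem branchSepDegree_eq_finrank_separableClosure_of_node (h131d : Lipman1969_13_1_d_rat.{0})
    (hdim : ringKrullDim S = 2) (hS : HasRationalSingularity S) (hψ : IsResolution (ρ ≫ π))
    {η1 n y : X1} (hη1 : η1 ∈ excCurvePoints (ρ ≫ π)) (hn : n ∈ excCurvePoints (ρ ≫ π)) (hne : η1 ≠ n)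
    (hy1 : η1 ⤳ y) (hy2 : n ⤳ y) (hfib : ρ.base ⁻¹' {ρ.base y} ⊆ closure {n})
    (hbij : Function.Bijective (ρ.stalkMap η1))
    {h : ρ.base η1 ⤳ ρ.base y} {V : ValuationSubring (X.residueField (ρ.base η1))}
    (hb : IsBranchAt (ρ.base y) (ρ.base η1) h V) :
    letI : Algebra (X.residueField (ρ.base y)) (X1.residueField y) := (ρ.residueFieldMap y).hom.toAlgebra
    branchSepDegree (ρ.base y) (ρ.base η1) h V hb =
      Module.finrank (X.residueField (ρ.base y)) (separableClosure (X.residueField (ρ.base y)) (X1.residueField y)) := by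
  -- the residue field identification `e : κ(η) ≃ κ(η¹)` and the transported branch `V¹`
  let e : X.residueField (ρ.base η1) ≃+* X1.residueField η1 :=
    RingEquiv.ofBijective (ρ.residueFieldMap η1).hom (residueFieldMap_bijective_of_stalkMap_bijective ρ η1 hbij)
  have he : ∀ t, e t = (ρ.residueFieldMap η1).hom t := fun _ => rfl
  obtain ⟨-, hb1, hW, hV1⟩ := isBranchAt_comap_symm_of_node ρ h131d hdim hS hψ hη1 hn hne hy1 hy2 hfib e he h hb
  set V1 : ValuationSubring (X1.residueField η1) := V.comap e.symm.toRingHom with hV1def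
  -- the three local maps: `τ : 𝒪_(X,z) → V`, `ψ : 𝒪_(X¹,y) → V¹` (onto), `r : V ≃ V¹`
  let τ := toBranch (ρ.base y) (ρ.base η1) h V hb
  haveI hτ : IsLocalHom τ := isLocalHom_toBranch _ _ h V hb
  let ψ := toBranch y η1 hy1 V1 hb1
  haveI hψloc : IsLocalHom ψ := isLocalHom_toBranch y η1 hy1 V1 hb1
  have hψsurj : Function.Surjective ψ := toBranch_surjective_of_forall_mem_or_inv_mem hy1 hW hb1
  have hr_mem : ∀ v : V, e (v : X.residueField (ρ.base η1)) ∈ V1 := fun v => by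
    rw [hV1def, ValuationSubring.mem_comap]
    change e.symm (e v) ∈ V
    rw [e.symm_apply_apply]; exact v.2
  let r₀ : V →+* V1 := (e.toRingHom.comp V.subtype).codRestrict V1.toSubring hr_mem
  have hr₀ : Function.Bijective r₀ := by
    refine ⟨fun v w hvw => Subtype.ext (e.injective (congrArg Subtype.val hvw)), fun w => ?_⟩
    have hw : (w : X1.residueField η1) ∈ V.comap e.symm.toRingHom := w.2
    exact ⟨⟨e.symm w, ValuationSubring.mem_comap.mp hw⟩, Subtype.ext (e.apply_symm_apply w)⟩
  let r : V ≃+* V1 := RingEquiv.ofBijective r₀ hr₀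
  -- `ψ ∘ ρ^*_y = r ∘ τ : 𝒪_(X, ρ y) → V¹` (checked in `κ(η¹)`)
  have hcomp : ψ.comp (ρ.stalkMap y).hom = r.toRingHom.comp τ := by
    apply RingHom.ext
    intro a
    apply Subtype.ext
    change (X1.residue η1).hom ((X1.presheaf.stalkSpecializes hy1).hom ((ρ.stalkMap y).hom a)) =
      e ((X.residue (ρ.base η1)).hom ((X.presheaf.stalkSpecializes h).hom a))
    rw [he]
    change (ρ.stalkMap y ≫ X1.presheaf.stalkSpecializes hy1 ≫ X1.residue η1).hom a =
      (X.presheaf.stalkSpecializes h ≫ X.residue (ρ.base η1) ≫ ρ.residueFieldMap η1).hom a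
    rw [Scheme.residue_residueFieldMap, ← Scheme.Hom.stalkSpecializes_stalkMap_assoc ρ η1 y hy1]
  -- the residue field isomorphism `Φ : κ(V) ≃ κ(y)` over `κ(ρ y)`
  have hψres : Function.Bijective (IsLocalRing.ResidueField.map ψ) := by
    refine ⟨(IsLocalRing.ResidueField.map ψ).injective, fun w => ?_⟩
    obtain ⟨v, rfl⟩ := IsLocalRing.residue_surjective w
    obtain ⟨s, rfl⟩ := hψsurj v
    exact ⟨IsLocalRing.residue _ s, IsLocalRing.ResidueField.map_residue ψ s⟩
  let Φr : IsLocalRing.ResidueField V ≃+* X1.residueField y :=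
    (IsLocalRing.ResidueField.mapEquiv r).trans (RingEquiv.ofBijective _ hψres).symm
  letI algV : Algebra (X.residueField (ρ.base y)) (IsLocalRing.ResidueField V) :=
    (IsLocalRing.ResidueField.map τ).toAlgebra
  letI algy : Algebra (X.residueField (ρ.base y)) (X1.residueField y) := (ρ.residueFieldMap y).hom.toAlgebra
  have hΦ : ∀ c : X.residueField (ρ.base y),
      Φr (algebraMap (X.residueField (ρ.base y)) (IsLocalRing.ResidueField V) c) =
        algebraMap (X.residueField (ρ.base y)) (X1.residueField y) c := by
    intro c
    change Φr (IsLocalRing.ResidueField.map τ c) = (ρ.residueFieldMap y).hom c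
    -- it suffices to check after `κ(y) ≅ κ(V¹)`
    apply (RingEquiv.ofBijective _ hψres).injective
    change (RingEquiv.ofBijective _ hψres) ((RingEquiv.ofBijective _ hψres).symm
      (IsLocalRing.ResidueField.mapEquiv r (IsLocalRing.ResidueField.map τ c))) = _
    rw [RingEquiv.apply_symm_apply, IsLocalRing.ResidueField.mapEquiv_apply]
    change IsLocalRing.ResidueField.map (r : V →+* V1) (IsLocalRing.ResidueField.map τ c) =
      IsLocalRing.ResidueField.map ψ (IsLocalRing.ResidueField.map (ρ.stalkMap y).hom c)
    rw [IsLocalRing.ResidueField.map_map, IsLocalRing.ResidueField.map_map]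
    congr 2
    exact hcomp.symm
  let Φ : IsLocalRing.ResidueField V ≃ₐ[X.residueField (ρ.base y)] X1.residueField y := AlgEquiv.ofRingEquiv hΦ
  -- `branchSepDegree` unfolds to the separable degree of `κ(V)` over `κ(ρ y)` with the algebra `algV`
  change Module.finrank (X.residueField (ρ.base y))
      (separableClosure (X.residueField (ρ.base y)) (IsLocalRing.ResidueField V)) = _
  exact (separableClosure.algEquivOfAlgEquiv Φ).toLinearEquiv.finrank_eq

/-- **(S1) DOWNSTAIRS SEP-JUMP at a self-node.**  Let `z ∈ sepNodes π` be a node through which `η = ρ η¹` is the ONLY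
integral exceptional curve of `π`, `y` THE point of `E¹ = closure {η¹}` on the node curve `n` (`ρ⁻¹{z} ⊆ closure {n}`).
Then the two geometric branches that make `z` a node are NOT two branch data (`eq_of_isBranchAt_of_isBranchAt_of_node`)
but one branch of separable residue degree `≥ 2`, whose residue field is `κ(y)`: **`2 ≤ [κ(y)^s : κ(ρ y)]`** along
`ρ.residueFieldMap y` (and `ρ y = z`).  Conditional on `Lipman1969_13_1_d_rat` through (T1)/(T3).
[cite: Lipman1969, Proposition (13.1) d) (p. 223) and §16 (16.1) (p. 231)] -/
theorem two_le_finrank_separableClosure_of_selfNode (h131d : Lipman1969_13_1_d_rat.{0}) (hdim : ringKrullDim S = 2)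
    (hS : HasRationalSingularity S) (hψ : IsResolution (ρ ≫ π))
    {η1 n y : X1} (hη1 : η1 ∈ excCurvePoints (ρ ≫ π)) (hn : n ∈ excCurvePoints (ρ ≫ π)) (hne : η1 ≠ n)
    (hy1 : η1 ⤳ y) (hy2 : n ⤳ y) {z : X} (hz : z ∈ sepNodes π) (hnz : ρ.base n = z)
    (hfib : ρ.base ⁻¹' {z} ⊆ closure {n})
    (honly : ∀ η' ∈ excCurvePoints π, η' ⤳ z → η' = ρ.base η1) (hbij : Function.Bijective (ρ.stalkMap η1)) :
    letI : Algebra (X.residueField (ρ.base y)) (X1.residueField y) := (ρ.residueFieldMap y).hom.toAlgebra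
    2 ≤ Module.finrank (X.residueField (ρ.base y)) (separableClosure (X.residueField (ρ.base y)) (X1.residueField y)) := by
  have hρy : ρ.base y = z := base_eq_of_specializes_of_mem_sepNodes ρ hz hnz hy2
  subst hρy
  obtain ⟨-, hsep⟩ := (mem_sepNodes_iff π (ρ.base y)).mp hz
  rcases hsep with ⟨⟨ηb, Vb⟩, ⟨ηb', Vb'⟩, hbb, ⟨hbE, hbh, hbB⟩, ⟨hbE', hbh', hbB'⟩⟩ | ⟨η', h', V, hbV, hη'E, h2⟩
  · -- two branch data at `z`: both on `η` (no other curve), hence equal — contradiction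
    exfalso
    dsimp only at hbE hbh hbB hbE' hbh' hbB'
    have hηb : ηb = ρ.base η1 := honly ηb hbE hbh
    have hηb' : ηb' = ρ.base η1 := honly ηb' hbE' hbh'
    subst hηb
    subst hηb'
    exact hbb (by rw [eq_of_isBranchAt_of_isBranchAt_of_node ρ h131d hdim hS hψ hη1 hn hne hy1 hy2 hfib hbij hbB hbB'])
  · -- one branch of separable residue degree `≥ 2`, on `η`
    have hη' : η' = ρ.base η1 := honly η' hη'E h'
    subst hη'
    rw [branchSepDegree_eq_finrank_separableClosure_of_node ρ h131d hdim hS hψ hη1 hn hne hy1 hy2 hfib hbij hbV] at h2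
    exact h2

end SelfNode

end Summit.ResolutionOfSingularities.ResolutionOfSingularities.Theorems.NoZeno.ExcCount

end
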